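import Summits.ResolutionOfSingularities.ResolutionOfSingularities.Theorems.FrobeniusClosingPatchingRelPerfectConeDepthSmoothConeRung
import Summits.ResolutionOfSingularities.ResolutionOfSingularities.Theorems.FrobeniusClosingPatchingRelPerfectConeDepthSmoothQuadricDisc
import HarnessLib

/-!
# Crux `PatchingRelPerfect` (stmt-ResolutionOfSingularities-16161), chain W5.2 — RUNG «r-diag-cone-ℓ» BY NAME: the DIAGONAL conic
# cones `α x₀² + β x₁² + γ x₂²` (`2, α, β, γ` units) at every depth — every rank-3 quadric in odd residue characteristic, incl. the
# ANISOTROPIC conic cones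

[OURS · L1 W5.2 · rung tool] Replaces the role of NO printed item; NOT a statement of the manuscript under review; fact-free,
any residue field of characteristic `≠ 2`, no completeness, no coefficient field.  AI-written (AI review is weaker than expert review).

`S` regular local of dimension `4` with `2 ∈ S×`, `x₀, …, x₃` a regular system of parameters, `α, β, γ ∈ S×`,
`q = α x₀² + β x₁² + γ x₂²` — the cone over the smooth conic `ᾱU₀² + β̄U₁² + γ̄U₂² = 0`, which may have NO rational point
(anisotropic ternary form: then no chart of the strict transform of `V(q)` is a graph and the vertex is the only rational point of
the exceptional conic cone).  THEN `(q) + 𝔪^{ℓ+2} ∈ 𝒞` for EVERY `ℓ` with the blow-up-form core conclusion (`diagConeRung_of_ringKrullDim`,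
core dress `atomDimFourBlowupAt_diagCone`) — `smoothConeRung_of_ringKrullDim` at `d = 2` with the certificates: (HV) with `m = 1`
(`T_k = (2c̄_k)⁻¹ ∂_kF₀`), (HC) from `2F_i − Σ T_k ∂_kF_i = 2c̄_{i-1}`.  Up to a unit and a linear change of parameters every ternary
quadratic form with unit discriminant over `S` with `2 ∈ S×` is of this shape, so together with g4's split cone `x₀x₁ + x₂²` (any
characteristic) this closes the RANK-3 quadric one-form graded members at every depth.

## References
* J. Kollár, *Lectures on Resolution of Singularities* (2007), 3.61, (3.111) Step 3. [Kollar2007]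
* H. Matsumura, *Commutative Ring Theory*, CUP 1986, Thm. 30.3. [Matsumura1987]
* The Stacks Project, Tag 080A. [StacksProject]
-/

set_option linter.dupNamespace false

noncomputable section

open CategoryTheory CategoryTheory.Limits AlgebraicGeometry TopologicalSpace IsLocalRing
open Literature.AlgebraicGeometry.Resolution
open Scheme.IdealSheafData
open scoped Pointwise

namespace Summit.ResolutionOfSingularities.ResolutionOfSingularities.Theorems

universe u

namespace ConeDepth

/-! ## The diagonal ternary form and its certificates -/

section DiagForm

variable {S : Type u} [CommRing S] (α β γ : S)

/-- `αU₀² + βU₁² + γU₂²` is a form of degree `2`. [folklore] -/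
theorem isHomogeneous_diagForm :
    (MvPolynomial.C α * (MvPolynomial.X 0 * MvPolynomial.X 0) + MvPolynomial.C β * (MvPolynomial.X 1 * MvPolynomial.X 1) +
      MvPolynomial.C γ * (MvPolynomial.X 2 * MvPolynomial.X 2) : MvPolynomial (Fin 3) S).IsHomogeneous 2 := by
  have hX : ∀ j : Fin 3, (MvPolynomial.X j : MvPolynomial (Fin 3) S).IsHomogeneous 1 := fun j =>
    MvPolynomial.isHomogeneous_X S j
  have hC : ∀ s : S, (MvPolynomial.C s : MvPolynomial (Fin 3) S).IsHomogeneous 0 := fun s =>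
    MvPolynomial.isHomogeneous_C _ s
  have h : ∀ (s : S) (j : Fin 3), (MvPolynomial.C s * (MvPolynomial.X j * MvPolynomial.X j) :
      MvPolynomial (Fin 3) S).IsHomogeneous 2 := fun s j => by
    simpa using (hC s).mul ((hX j).mul (hX j))
  exact ((h α 0).add (h β 1)).add (h γ 2)

/-- `N(x₀,x₁,x₂) = α x₀² + β x₁² + γ x₂²`. [folklore] -/
theorem eval_diagForm (x : Fin 4 → S) :
    MvPolynomial.eval (fun k : Fin 3 => x k.castSucc)
      (MvPolynomial.C α * (MvPolynomial.X 0 * MvPolynomial.X 0) + MvPolynomial.C β * (MvPolynomial.X 1 * MvPolynomial.X 1) +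
        MvPolynomial.C γ * (MvPolynomial.X 2 * MvPolynomial.X 2)) = α * x 0 ^ 2 + β * x 1 ^ 2 + γ * x 2 ^ 2 := by
  have h0 : (Fin.castSucc (0 : Fin 3) : Fin 4) = 0 := rfl
  have h1 : (Fin.castSucc (1 : Fin 3) : Fin 4) = 1 := rfl
  have h2 : (Fin.castSucc (2 : Fin 3) : Fin 4) = 2 := rfl
  simp only [map_add, map_mul, MvPolynomial.eval_C, MvPolynomial.eval_X, h0, h1, h2]
  ring

variable [IsLocalRing S]

/-- The reduced chart polynomials of `αT₁² + βT₂² + γT₃²`. [folklore] -/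
theorem chartPoly_diagForm (i : Fin 4) :
    chartPoly (MvPolynomial.rename Fin.succ
      (MvPolynomial.C α * (MvPolynomial.X 0 * MvPolynomial.X 0) + MvPolynomial.C β * (MvPolynomial.X 1 * MvPolynomial.X 1) +
        MvPolynomial.C γ * (MvPolynomial.X 2 * MvPolynomial.X 2) : MvPolynomial (Fin 3) S)) i =
      MvPolynomial.C (residue S α) * (killVar i 1 * killVar i 1) + MvPolynomial.C (residue S β) * (killVar i 2 * killVar i 2) +
        MvPolynomial.C (residue S γ) * (killVar i 3 * killVar i 3) := by
  have h0 : (Fin.succ (0 : Fin 3) : Fin 4) = 1 := rfl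
  have h1 : (Fin.succ (1 : Fin 3) : Fin 4) = 2 := rfl
  have h2 : (Fin.succ (2 : Fin 3) : Fin 4) = 3 := rfl
  rw [chartPoly_rename_succ]
  simp only [map_add, map_mul, MvPolynomial.map_C, MvPolynomial.map_X, MvPolynomial.aeval_X, MvPolynomial.algHom_C,
    MvPolynomial.algebraMap_eq, h0, h1, h2]

/-- **(HV) for the diagonal conic cone, with `m = 1`**: `T_k = (2c̄_k)⁻¹ · ∂F₀/∂T_k`. [cite: Matsumura1987, Thm. 30.3] -/
theorem diagForm_HV (h2 : IsUnit (2 : S)) (hα : IsUnit α) (hβ : IsUnit β) (hγ : IsUnit γ) :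
    ∃ m : ℕ, Ideal.span (Set.range (MvPolynomial.X : {j : Fin 4 // j ≠ (0 : Fin 4)} → _)) ^ m ≤
      Ideal.span (insert (chartPoly (MvPolynomial.rename Fin.succ
        (MvPolynomial.C α * (MvPolynomial.X 0 * MvPolynomial.X 0) + MvPolynomial.C β * (MvPolynomial.X 1 * MvPolynomial.X 1) +
          MvPolynomial.C γ * (MvPolynomial.X 2 * MvPolynomial.X 2) : MvPolynomial (Fin 3) S)) 0)
        (Set.range fun t => MvPolynomial.pderiv t (chartPoly (MvPolynomial.rename Fin.succ
          (MvPolynomial.C α * (MvPolynomial.X 0 * MvPolynomial.X 0) + MvPolynomial.C β * (MvPolynomial.X 1 * MvPolynomial.X 1) +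
            MvPolynomial.C γ * (MvPolynomial.X 2 * MvPolynomial.X 2) : MvPolynomial (Fin 3) S)) 0))) := by
  classical
  have h2' : (2 : ResidueField S) ≠ 0 := by
    have h := (h2.map (residue S)).ne_zero; rwa [map_ofNat] at h
  refine ⟨1, ?_⟩
  rw [pow_one, chartPoly_diagForm, killVar_of_ne 0 1 (by decide), killVar_of_ne 0 2 (by decide), killVar_of_ne 0 3 (by decide)]
  set F : MvPolynomial {j : Fin 4 // j ≠ (0 : Fin 4)} (ResidueField S) :=
    MvPolynomial.C (residue S α) * (MvPolynomial.X ⟨1, by decide⟩ * MvPolynomial.X ⟨1, by decide⟩) +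
      MvPolynomial.C (residue S β) * (MvPolynomial.X ⟨2, by decide⟩ * MvPolynomial.X ⟨2, by decide⟩) +
      MvPolynomial.C (residue S γ) * (MvPolynomial.X ⟨3, by decide⟩ * MvPolynomial.X ⟨3, by decide⟩) with hF
  set I := Ideal.span (insert F (Set.range fun t => MvPolynomial.pderiv t F)) with hI
  have hdF : ∀ t, MvPolynomial.pderiv t F ∈ I := fun t => Ideal.subset_span (Set.mem_insert_of_mem _ (Set.mem_range_self t))
  -- the three partial derivatives
  have hp1 : MvPolynomial.pderiv (⟨1, by decide⟩ : {j : Fin 4 // j ≠ (0 : Fin 4)}) F =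
      2 * (MvPolynomial.C (residue S α) * MvPolynomial.X ⟨1, by decide⟩) := by
    rw [hF]; simp [MvPolynomial.pderiv_X]; ring
  have hp2 : MvPolynomial.pderiv (⟨2, by decide⟩ : {j : Fin 4 // j ≠ (0 : Fin 4)}) F =
      2 * (MvPolynomial.C (residue S β) * MvPolynomial.X ⟨2, by decide⟩) := by
    rw [hF]; simp [MvPolynomial.pderiv_X]; ring
  have hp3 : MvPolynomial.pderiv (⟨3, by decide⟩ : {j : Fin 4 // j ≠ (0 : Fin 4)}) F =
      2 * (MvPolynomial.C (residue S γ) * MvPolynomial.X ⟨3, by decide⟩) := by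
    rw [hF]; simp [MvPolynomial.pderiv_X]; ring
  -- each variable is a unit multiple of a partial derivative
  have hX : ∀ (t : {j : Fin 4 // j ≠ (0 : Fin 4)}) (c : ResidueField S), c ≠ 0 →
      MvPolynomial.pderiv t F = 2 * (MvPolynomial.C c * MvPolynomial.X t) → (MvPolynomial.X t : MvPolynomial _ _) ∈ I := by
    intro t c hc ht
    have heq : (MvPolynomial.X t : MvPolynomial {j : Fin 4 // j ≠ (0 : Fin 4)} (ResidueField S)) =
        MvPolynomial.C (2 * c)⁻¹ * MvPolynomial.pderiv t F := by
      rw [ht, show (2 : MvPolynomial {j : Fin 4 // j ≠ (0 : Fin 4)} (ResidueField S)) * (MvPolynomial.C c * MvPolynomial.X t) =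
        MvPolynomial.C (2 * c) * MvPolynomial.X t by rw [map_mul, map_ofNat]; ring,
        ← mul_assoc, ← map_mul, inv_mul_cancel₀ (mul_ne_zero h2' hc), map_one, one_mul]
    rw [heq]
    exact I.mul_mem_left _ (hdF t)
  have hX1 := hX _ _ (hα.map (residue S)).ne_zero hp1
  have hX2 := hX _ _ (hβ.map (residue S)).ne_zero hp2
  have hX3 := hX _ _ (hγ.map (residue S)).ne_zero hp3
  rw [Ideal.span_le]
  rintro _ ⟨⟨k, hk⟩, rfl⟩
  fin_cases k
  · exact absurd rfl hk
  · exact hX1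
  · exact hX2
  · exact hX3

/-- (HC) on the chart `T₁ = 1`: `2F₁ − T₂∂₂F₁ − T₃∂₃F₁ = 2ᾱ`. [cite: Matsumura1987, Thm. 30.3] -/
theorem diagForm_HC_one (h2 : IsUnit (2 : S)) (hα : IsUnit α) :
    Ideal.span (insert (chartPoly (MvPolynomial.rename Fin.succ
      (MvPolynomial.C α * (MvPolynomial.X 0 * MvPolynomial.X 0) + MvPolynomial.C β * (MvPolynomial.X 1 * MvPolynomial.X 1) +
        MvPolynomial.C γ * (MvPolynomial.X 2 * MvPolynomial.X 2) : MvPolynomial (Fin 3) S)) 1)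
      (Set.range fun t => MvPolynomial.pderiv t (chartPoly (MvPolynomial.rename Fin.succ
        (MvPolynomial.C α * (MvPolynomial.X 0 * MvPolynomial.X 0) + MvPolynomial.C β * (MvPolynomial.X 1 * MvPolynomial.X 1) +
          MvPolynomial.C γ * (MvPolynomial.X 2 * MvPolynomial.X 2) : MvPolynomial (Fin 3) S)) 1))) = ⊤ := by
  classical
  have h2' : (2 : ResidueField S) ≠ 0 := by
    have h := (h2.map (residue S)).ne_zero; rwa [map_ofNat] at h
  rw [chartPoly_diagForm, killVar_self, killVar_of_ne 1 2 (by decide), killVar_of_ne 1 3 (by decide), mul_one]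
  set F : MvPolynomial {j : Fin 4 // j ≠ (1 : Fin 4)} (ResidueField S) :=
    MvPolynomial.C (residue S α) * 1 +
      MvPolynomial.C (residue S β) * (MvPolynomial.X ⟨2, by decide⟩ * MvPolynomial.X ⟨2, by decide⟩) +
      MvPolynomial.C (residue S γ) * (MvPolynomial.X ⟨3, by decide⟩ * MvPolynomial.X ⟨3, by decide⟩) with hF
  set I := Ideal.span (insert F (Set.range fun t => MvPolynomial.pderiv t F)) with hI
  have hFI : F ∈ I := Ideal.subset_span (Set.mem_insert _ _)
  have hdF : ∀ t, MvPolynomial.pderiv t F ∈ I := fun t => Ideal.subset_span (Set.mem_insert_of_mem _ (Set.mem_range_self t))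
  have hp2 : MvPolynomial.pderiv (⟨2, by decide⟩ : {j : Fin 4 // j ≠ (1 : Fin 4)}) F =
      2 * (MvPolynomial.C (residue S β) * MvPolynomial.X ⟨2, by decide⟩) := by
    rw [hF]; simp [MvPolynomial.pderiv_X]; ring
  have hp3 : MvPolynomial.pderiv (⟨3, by decide⟩ : {j : Fin 4 // j ≠ (1 : Fin 4)}) F =
      2 * (MvPolynomial.C (residue S γ) * MvPolynomial.X ⟨3, by decide⟩) := by
    rw [hF]; simp [MvPolynomial.pderiv_X]; ring
  have hmem : MvPolynomial.C 2 * F - MvPolynomial.X ⟨2, by decide⟩ * MvPolynomial.pderiv ⟨2, by decide⟩ F -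
      MvPolynomial.X ⟨3, by decide⟩ * MvPolynomial.pderiv ⟨3, by decide⟩ F ∈ I :=
    I.sub_mem (I.sub_mem (I.mul_mem_left _ hFI) (I.mul_mem_left _ (hdF _))) (I.mul_mem_left _ (hdF _))
  refine ideal_eq_top_of_mem_of_eq_C hmem ?_ (mul_ne_zero h2' (hα.map (residue S)).ne_zero)
  rw [hp2, hp3, hF, map_mul, map_ofNat]
  ring

/-- (HC) on the chart `T₂ = 1`: `2F₂ − T₁∂₁F₂ − T₃∂₃F₂ = 2β̄`. [cite: Matsumura1987, Thm. 30.3] -/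
theorem diagForm_HC_two (h2 : IsUnit (2 : S)) (hβ : IsUnit β) :
    Ideal.span (insert (chartPoly (MvPolynomial.rename Fin.succ
      (MvPolynomial.C α * (MvPolynomial.X 0 * MvPolynomial.X 0) + MvPolynomial.C β * (MvPolynomial.X 1 * MvPolynomial.X 1) +
        MvPolynomial.C γ * (MvPolynomial.X 2 * MvPolynomial.X 2) : MvPolynomial (Fin 3) S)) 2)
      (Set.range fun t => MvPolynomial.pderiv t (chartPoly (MvPolynomial.rename Fin.succ
        (MvPolynomial.C α * (MvPolynomial.X 0 * MvPolynomial.X 0) + MvPolynomial.C β * (MvPolynomial.X 1 * MvPolynomial.X 1) +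
          MvPolynomial.C γ * (MvPolynomial.X 2 * MvPolynomial.X 2) : MvPolynomial (Fin 3) S)) 2))) = ⊤ := by
  classical
  have h2' : (2 : ResidueField S) ≠ 0 := by
    have h := (h2.map (residue S)).ne_zero; rwa [map_ofNat] at h
  rw [chartPoly_diagForm, killVar_self, killVar_of_ne 2 1 (by decide), killVar_of_ne 2 3 (by decide), mul_one]
  set F : MvPolynomial {j : Fin 4 // j ≠ (2 : Fin 4)} (ResidueField S) :=
    MvPolynomial.C (residue S α) * (MvPolynomial.X ⟨1, by decide⟩ * MvPolynomial.X ⟨1, by decide⟩) +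
      MvPolynomial.C (residue S β) * 1 +
      MvPolynomial.C (residue S γ) * (MvPolynomial.X ⟨3, by decide⟩ * MvPolynomial.X ⟨3, by decide⟩) with hF
  set I := Ideal.span (insert F (Set.range fun t => MvPolynomial.pderiv t F)) with hI
  have hFI : F ∈ I := Ideal.subset_span (Set.mem_insert _ _)
  have hdF : ∀ t, MvPolynomial.pderiv t F ∈ I := fun t => Ideal.subset_span (Set.mem_insert_of_mem _ (Set.mem_range_self t))
  have hp1 : MvPolynomial.pderiv (⟨1, by decide⟩ : {j : Fin 4 // j ≠ (2 : Fin 4)}) F =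
      2 * (MvPolynomial.C (residue S α) * MvPolynomial.X ⟨1, by decide⟩) := by
    rw [hF]; simp [MvPolynomial.pderiv_X]; ring
  have hp3 : MvPolynomial.pderiv (⟨3, by decide⟩ : {j : Fin 4 // j ≠ (2 : Fin 4)}) F =
      2 * (MvPolynomial.C (residue S γ) * MvPolynomial.X ⟨3, by decide⟩) := by
    rw [hF]; simp [MvPolynomial.pderiv_X]; ring
  have hmem : MvPolynomial.C 2 * F - MvPolynomial.X ⟨1, by decide⟩ * MvPolynomial.pderiv ⟨1, by decide⟩ F -
      MvPolynomial.X ⟨3, by decide⟩ * MvPolynomial.pderiv ⟨3, by decide⟩ F ∈ I :=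
    I.sub_mem (I.sub_mem (I.mul_mem_left _ hFI) (I.mul_mem_left _ (hdF _))) (I.mul_mem_left _ (hdF _))
  refine ideal_eq_top_of_mem_of_eq_C hmem ?_ (mul_ne_zero h2' (hβ.map (residue S)).ne_zero)
  rw [hp1, hp3, hF, map_mul, map_ofNat]
  ring

/-- (HC) on the chart `T₃ = 1`: `2F₃ − T₁∂₁F₃ − T₂∂₂F₃ = 2γ̄`. [cite: Matsumura1987, Thm. 30.3] -/
theorem diagForm_HC_three (h2 : IsUnit (2 : S)) (hγ : IsUnit γ) :
    Ideal.span (insert (chartPoly (MvPolynomial.rename Fin.succ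
      (MvPolynomial.C α * (MvPolynomial.X 0 * MvPolynomial.X 0) + MvPolynomial.C β * (MvPolynomial.X 1 * MvPolynomial.X 1) +
        MvPolynomial.C γ * (MvPolynomial.X 2 * MvPolynomial.X 2) : MvPolynomial (Fin 3) S)) 3)
      (Set.range fun t => MvPolynomial.pderiv t (chartPoly (MvPolynomial.rename Fin.succ
        (MvPolynomial.C α * (MvPolynomial.X 0 * MvPolynomial.X 0) + MvPolynomial.C β * (MvPolynomial.X 1 * MvPolynomial.X 1) +
          MvPolynomial.C γ * (MvPolynomial.X 2 * MvPolynomial.X 2) : MvPolynomial (Fin 3) S)) 3))) = ⊤ := by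
  classical
  have h2' : (2 : ResidueField S) ≠ 0 := by
    have h := (h2.map (residue S)).ne_zero; rwa [map_ofNat] at h
  rw [chartPoly_diagForm, killVar_self, killVar_of_ne 3 1 (by decide), killVar_of_ne 3 2 (by decide), mul_one]
  set F : MvPolynomial {j : Fin 4 // j ≠ (3 : Fin 4)} (ResidueField S) :=
    MvPolynomial.C (residue S α) * (MvPolynomial.X ⟨1, by decide⟩ * MvPolynomial.X ⟨1, by decide⟩) +
      MvPolynomial.C (residue S β) * (MvPolynomial.X ⟨2, by decide⟩ * MvPolynomial.X ⟨2, by decide⟩) +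
      MvPolynomial.C (residue S γ) * 1 with hF
  set I := Ideal.span (insert F (Set.range fun t => MvPolynomial.pderiv t F)) with hI
  have hFI : F ∈ I := Ideal.subset_span (Set.mem_insert _ _)
  have hdF : ∀ t, MvPolynomial.pderiv t F ∈ I := fun t => Ideal.subset_span (Set.mem_insert_of_mem _ (Set.mem_range_self t))
  have hp1 : MvPolynomial.pderiv (⟨1, by decide⟩ : {j : Fin 4 // j ≠ (3 : Fin 4)}) F =
      2 * (MvPolynomial.C (residue S α) * MvPolynomial.X ⟨1, by decide⟩) := by
    rw [hF]; simp [MvPolynomial.pderiv_X]; ring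
  have hp2 : MvPolynomial.pderiv (⟨2, by decide⟩ : {j : Fin 4 // j ≠ (3 : Fin 4)}) F =
      2 * (MvPolynomial.C (residue S β) * MvPolynomial.X ⟨2, by decide⟩) := by
    rw [hF]; simp [MvPolynomial.pderiv_X]; ring
  have hmem : MvPolynomial.C 2 * F - MvPolynomial.X ⟨1, by decide⟩ * MvPolynomial.pderiv ⟨1, by decide⟩ F -
      MvPolynomial.X ⟨2, by decide⟩ * MvPolynomial.pderiv ⟨2, by decide⟩ F ∈ I :=
    I.sub_mem (I.sub_mem (I.mul_mem_left _ hFI) (I.mul_mem_left _ (hdF _))) (I.mul_mem_left _ (hdF _))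
  refine ideal_eq_top_of_mem_of_eq_C hmem ?_ (mul_ne_zero h2' (hγ.map (residue S)).ne_zero)
  rw [hp1, hp2, hF, map_mul, map_ofNat]
  ring

/-- **(HC) for the diagonal conic cone** on every chart `i ≠ 0`. [cite: Matsumura1987, Thm. 30.3] -/
theorem diagForm_HC (h2 : IsUnit (2 : S)) (hα : IsUnit α) (hβ : IsUnit β) (hγ : IsUnit γ) (i : Fin 4) (hi : i ≠ 0) :
    Ideal.span (insert (chartPoly (MvPolynomial.rename Fin.succ
      (MvPolynomial.C α * (MvPolynomial.X 0 * MvPolynomial.X 0) + MvPolynomial.C β * (MvPolynomial.X 1 * MvPolynomial.X 1) +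
        MvPolynomial.C γ * (MvPolynomial.X 2 * MvPolynomial.X 2) : MvPolynomial (Fin 3) S)) i)
      (Set.range fun t => MvPolynomial.pderiv t (chartPoly (MvPolynomial.rename Fin.succ
        (MvPolynomial.C α * (MvPolynomial.X 0 * MvPolynomial.X 0) + MvPolynomial.C β * (MvPolynomial.X 1 * MvPolynomial.X 1) +
          MvPolynomial.C γ * (MvPolynomial.X 2 * MvPolynomial.X 2) : MvPolynomial (Fin 3) S)) i))) = ⊤ := by
  fin_cases i
  · exact absurd rfl hi
  · exact diagForm_HC_one α β γ h2 hα
  · exact diagForm_HC_two α β γ h2 hβ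
  · exact diagForm_HC_three α β γ h2 hγ

end DiagForm

/-! ## The rung «r-diag-cone-ℓ» -/

section DiagRung

variable {S : Type u} [CommRing S] [IsRegularLocalRing S]
  (x : Fin 4 → S) (hx : Ideal.span (Set.range x) = maximalIdeal S) (hdim : ringKrullDim S = (4 : ℕ))
  (α β γ : S) (h2 : IsUnit (2 : S)) (hα : IsUnit α) (hβ : IsUnit β) (hγ : IsUnit γ) (ℓ : ℕ)

include hx hdim h2 hα hβ hγ in
/-- **RUNG «r-diag-cone-ℓ», UNCONDITIONAL PACKAGE**: for `S` regular local of dimension `4` with `2 ∈ S×`, `x` spanning `𝔪`,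
units `α, β, γ`, `q = α x₀² + β x₁² + γ x₂²` and EVERY `ℓ`: (1) `(q) + 𝔪^{ℓ+2} ∈ 𝒞`; (2) the blow-up-form core conclusion for every
`T = Bl_I Spec S`, `I = (q) + 𝔪^{ℓ+2}`.  Covers the ANISOTROPIC conic cones (no rational point on the exceptional conic but the
vertex); every residue field of characteristic `≠ 2`, no completeness, fact-free. [cite: Kollar2007, 3.61 and (3.111) Step 3]
[cite: StacksProject, Tag 080A] -/
theorem diagConeRung_of_ringKrullDim :
    (∃ (Q : Ideal S) (m : ℕ), IsLocalRing.maximalIdeal S ^ m ≤ Q ∧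
      ∃ (B' : Scheme.{u}) (b : B' ⟶ Spec (.of S)),
        IsBlowup b (affineBlowup.idealSheaf
          ((Ideal.span {α * x 0 ^ 2 + β * x 1 ^ 2 + γ * x 2 ^ 2} ⊔ maximalIdeal S ^ (ℓ + 2)) * Q)) ∧
        Scheme.IsRegular B') ∧
    (∀ (T : Scheme.{u}) (f : T ⟶ Spec (.of S)),
      IsBlowup f (affineBlowup.idealSheaf
        (Ideal.span {α * x 0 ^ 2 + β * x 1 ^ 2 + γ * x 2 ^ 2} ⊔ maximalIdeal S ^ (ℓ + 2))) →
      ∃ (J : T.IdealSheafData) (T' : Scheme.{u}) (π : T' ⟶ T), J ≠ ⊥ ∧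
        (∀ t : T, t ∈ J.support → f.base t = IsLocalRing.closedPoint S) ∧
        IsBlowup π J ∧ Scheme.IsRegular T') := by
  rw [← eval_diagForm α β γ x]
  exact smoothConeRung_of_ringKrullDim x hx hdim 2 le_rfl _ (isHomogeneous_diagForm α β γ) (diagForm_HV α β γ h2 hα hβ hγ)
    (diagForm_HC α β γ h2 hα hβ hγ) ℓ

end DiagRung

/-- **The registered core's binder shape on the member `(α x₀² + β x₁² + γ x₂²) + 𝔪^{ℓ+2}`**, `p ≠ 2`, `α, β, γ` units
(hypotheses of `stub_atomDimFourBlowup`; completeness, perfectness and the off-fibre hypothesis unused). [cite: Kollar2007, 3.61] -/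
theorem atomDimFourBlowupAt_diagCone (p : ℕ) (_hp : p.Prime) (S : Type) [CommRing S]
    [IsRegularLocalRing S] [CharP S p] [IsAdicComplete (IsLocalRing.maximalIdeal S) S]
    [PerfectField (IsLocalRing.ResidueField S)] (hS : ringKrullDim S = (4 : ℕ))
    (x : Fin 4 → S) (hx : Ideal.span (Set.range x) = IsLocalRing.maximalIdeal S)
    (h2 : IsUnit (2 : S)) (α β γ : S) (hα : IsUnit α) (hβ : IsUnit β) (hγ : IsUnit γ) (ℓ : ℕ)
    (T : Scheme.{0}) (f : T ⟶ Spec (.of S))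
    (hf : IsBlowup f (affineBlowup.idealSheaf
      (Ideal.span {α * x 0 ^ 2 + β * x 1 ^ 2 + γ * x 2 ^ 2} ⊔ IsLocalRing.maximalIdeal S ^ (ℓ + 2))))
    (_hoff : ∀ t : T, f.base t ≠ IsLocalRing.closedPoint S → IsRegularLocalRing (T.presheaf.stalk t)) :
    ∃ (J : T.IdealSheafData) (T' : Scheme.{0}) (π : T' ⟶ T), J ≠ ⊥ ∧
      (∀ t : T, t ∈ J.support → f.base t = IsLocalRing.closedPoint S) ∧
      IsBlowup π J ∧ Scheme.IsRegular T' :=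
  (diagConeRung_of_ringKrullDim x hx hS α β γ h2 hα hβ hγ ℓ).2 T f hf

end ConeDepth

end Summit.ResolutionOfSingularities.ResolutionOfSingularities.Theorems

end
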